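import Summits.BirchSwinnertonDyer.BirchSwinnertonDyer.Theorems.ResidualThetaTransportAtTwoThetaLayerLambdaCongruenceAtTwoCuspSpanGenerationB1
import Mathlib.LinearAlgebra.Matrix.FixedDetMatrices
import HarnessLib

/-!
# Route `ResidualThetaTransportAtTwo`, cruxes Kan⁺ (stmt-BirchSwinnertonDyer-20688) / node 27436 / 21437: the POTENTIAL of an
# additive `𝔽₂`-character of `Γ₀(N)` on primitive vectors, and the symbol calculus that turns «`B₁` killed» into «`χ = 0`»

Cell `bsd-wall`, lead prover `bsd-wall-rtt-p3` g10 (2026-08-28). THEOREMS ONLY (no `def`, no `sorry`);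
`--supports stmt-BirchSwinnertonDyer-20688`; BSD is not proved by this.

SETTING. `χ : Γ₀(N) → ZMod 2` additive, killing the elements of trace `±2` (hypothesis `hsmall`, as in the sibling files).
A POTENTIAL for `χ` is a function `φ : ℤ → ℤ → ZMod 2` on primitive vectors `(x, y)` (= cusps `x/y`) with
`φ(γ(x,y)) = χ γ + φ(x,y)` for every `γ ∈ Γ₀(N)` (hypothesis `hφ`; such a `φ` is constructed in the sequel
`…CuspSpanB1GenTwoPrimes` at level `pq`). This file is the level-independent ENGINE:

* §1 `chi_eq_zero_of_fix` / `chi_eq_of_act_eq` — an element of `Γ₀(N)` fixing a non-zero integer vector up to sign has trace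
  `±2`, hence is killed; two elements moving a vector to the same place have the same `χ` (well-definedness of potentials).
* §2 the function `w ↦ φ(1, w)` («the potential at the cusp `1/w`»): it depends on `w mod N` (`phi_one_add_mul`), vanishes for `w`
  a unit when `χ` kills `B₁` (`phi_one_eq_zero_of_isCoprime`) and for `N ∣ w` (`phi_one_eq_zero_of_dvd`), and is invariant under
  the move `x ↦ 1 − u`, `u(x+1) ≡ 1 (mod N)` (`phi_one_one_sub_eq`) — the `B₁` element `(x+1, −1; Nk, u)` maps `(1,x)` to `(1, 1−u)`.
* §3 the SYMBOL FUNCTION `S(g) = φ(col₀ g) + φ(col₁ g)` on `SL₂(ℤ)`: when `d = g₁₁` is prime to `N`, `S(g) = φ(1, w)` with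
  `dw ≡ c` (`phi_col_eq_of_isCoprime_right`, via `g = β · (1 0; w 1)`, `β ∈ Γ₀(N)`); and the column swap (`…_left`); the τ-TRIANGLE
  `S(g) = S(gτ) + S(gτ²)` is used in the sequel as a plain rewrite.
* §4 `chi_eq_zero_of_phi_col_eq` — if `S ≡ 0` on `SL₂(ℤ)` then `g ↦ φ(col₁ g)` is right-invariant under `S, T`, hence under
  `SL₂(ℤ) = ⟨S, T⟩` (Mathlib `SpecialLinearGroup.SL2Z_generators`), so `χ γ = φ(col₁ γ) − φ(0,1) = 0` for every `γ ∈ Γ₀(N)`.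

This is the `𝔽₂`-shadow of Manin's symbol calculus on `P¹(ℤ/N)` written without homology: `S` is constant on `Γ₀(N)`-cosets,
the 2-term relation is the column swap, the 3-term relation is the triangle. References: [Manin1972] §1.5–1.7 (Manin symbols,
three-term relation); [Rademacher1929] §1; [Knapp1993] Prop. 11.1; [Pollack2003] Conj. 6.3 (the node served).
-/

set_option autoImplicit false
set_option linter.dupNamespace false

noncomputable section

open scoped MatrixGroups

open CongruenceSubgroup Literature.NumberTheory.EllipticCurves.ModularForms

namespace Summit.BirchSwinnertonDyer.BirchSwinnertonDyer.Theorems.SignedMuAtTwo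

namespace Potential

variable {N : ℕ} {χ : Gamma0 N → ZMod 2} {φ : ℤ → ℤ → ZMod 2}

/-! ## §0. Small tools -/

/-- An integer matrix `(a, b; c, d)` of determinant `1` is an element of `SL₂(ℤ)` with these entries. [folklore] -/
theorem exists_sl2_entries (a b c d : ℤ) (hdet : a * d - b * c = 1) :
    ∃ g : SL(2, ℤ), g 0 0 = a ∧ g 0 1 = b ∧ g 1 0 = c ∧ g 1 1 = d :=
  ⟨⟨!![a, b; c, d], by rw [Matrix.det_fin_two_of]; linear_combination hdet⟩, rfl, rfl, rfl, rfl⟩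

/-- The columns of an element of `SL₂(ℤ)` are primitive: `(g₀₁, g₁₁)` is coprime. [folklore] -/
theorem isCoprime_col_one (g : SL(2, ℤ)) : IsCoprime (g 0 1) (g 1 1) :=
  ⟨-(g 1 0), g 0 0, by linear_combination det_entries g⟩

/-- `χ 1 = 0` for an additive `χ`. [folklore] -/
theorem chi_one (hadd : ∀ γ δ : Gamma0 N, χ (γ * δ) = χ γ + χ δ) : χ 1 = 0 := by
  have h := hadd 1 1
  rw [mul_one] at h
  have h2 : χ 1 + χ 1 = 0 := CharTwo.add_self_eq_zero _
  rwa [← h] at h2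

/-- `χ(γ⁻¹) = χ γ` for an additive `𝔽₂`-valued `χ`. [folklore] -/
theorem chi_inv (hadd : ∀ γ δ : Gamma0 N, χ (γ * δ) = χ γ + χ δ) (γ : Gamma0 N) : χ γ⁻¹ = χ γ := by
  have h := hadd γ γ⁻¹
  rw [mul_inv_cancel, chi_one hadd] at h
  have h' : χ γ = -χ γ⁻¹ := add_eq_zero_iff_eq_neg.mp h.symm
  rw [h', CharTwo.neg_eq]

/-! ## §1. Elements fixing a vector up to sign are killed; well-definedness of potentials -/

/-- **An element of `Γ₀(N)` fixing a non-zero integer vector up to sign is killed**: if `γ(x, y) = ε(x, y)` with `ε = ±1` and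
`(x, y) ≠ 0` then `det(γ − ε) = 0`, so `tr γ = 2ε` and `hsmall` applies. [folklore] -/
theorem chi_eq_zero_of_fix
    (hsmall : ∀ γ : Gamma0 N, ((γ : SL(2, ℤ)) 0 0 + (γ : SL(2, ℤ)) 1 1).natAbs ≤ 2 → χ γ = 0)
    (γ : Gamma0 N) {x y ε : ℤ} (hxy : x ≠ 0 ∨ y ≠ 0) (hε : ε = 1 ∨ ε = -1)
    (h0 : (γ : SL(2, ℤ)) 0 0 * x + (γ : SL(2, ℤ)) 0 1 * y = ε * x)
    (h1 : (γ : SL(2, ℤ)) 1 0 * x + (γ : SL(2, ℤ)) 1 1 * y = ε * y) : χ γ = 0 := by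
  have hdet := det_entries (γ : SL(2, ℤ))
  set a := (γ : SL(2, ℤ)) 0 0
  set b := (γ : SL(2, ℤ)) 0 1
  set c := (γ : SL(2, ℤ)) 1 0
  set d := (γ : SL(2, ℤ)) 1 1
  have hε2 : ε * ε = 1 := by rcases hε with rfl | rfl <;> norm_num
  -- `det(γ - ε) · x = 0` and `det(γ - ε) · y = 0`
  have hx : ((a - ε) * (d - ε) - b * c) * x = 0 := by
    have e1 : (a - ε) * x + b * y = 0 := by linear_combination h0
    have e2 : c * x + (d - ε) * y = 0 := by linear_combination h1
    linear_combination (d - ε) * e1 - b * e2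
  have hy : ((a - ε) * (d - ε) - b * c) * y = 0 := by
    have e1 : (a - ε) * x + b * y = 0 := by linear_combination h0
    have e2 : c * x + (d - ε) * y = 0 := by linear_combination h1
    linear_combination (a - ε) * e2 - c * e1
  have hD : (a - ε) * (d - ε) - b * c = 0 := by
    rcases hxy with hx0 | hy0
    · exact (mul_eq_zero.mp hx).resolve_right hx0
    · exact (mul_eq_zero.mp hy).resolve_right hy0
  -- hence `a + d = 2ε`
  have htr : a + d = 2 * ε := by
    have e : (a + d) * ε = 2 := by linear_combination hdet + hε2 - hD
    calc a + d = (a + d) * ε * ε := by rw [mul_assoc, hε2, mul_one]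
      _ = 2 * ε := by rw [e]
  refine hsmall γ (le_of_eq ?_)
  show (a + d).natAbs = 2
  rw [htr]
  rcases hε with rfl | rfl <;> norm_num

/-- **Well-definedness of potentials**: two elements `γ, γ' ∈ Γ₀(N)` moving the same non-zero vector `(x, y)` to the same
vector have the same `χ` (`γ'⁻¹ γ` fixes `(x, y)`). [folklore] -/
theorem chi_eq_of_act_eq (hadd : ∀ γ δ : Gamma0 N, χ (γ * δ) = χ γ + χ δ)
    (hsmall : ∀ γ : Gamma0 N, ((γ : SL(2, ℤ)) 0 0 + (γ : SL(2, ℤ)) 1 1).natAbs ≤ 2 → χ γ = 0)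
    {γ γ' : Gamma0 N} {x y : ℤ} (hxy : x ≠ 0 ∨ y ≠ 0)
    (h0 : (γ : SL(2, ℤ)) 0 0 * x + (γ : SL(2, ℤ)) 0 1 * y = (γ' : SL(2, ℤ)) 0 0 * x + (γ' : SL(2, ℤ)) 0 1 * y)
    (h1 : (γ : SL(2, ℤ)) 1 0 * x + (γ : SL(2, ℤ)) 1 1 * y = (γ' : SL(2, ℤ)) 1 0 * x + (γ' : SL(2, ℤ)) 1 1 * y) :
    χ γ = χ γ' := by
  -- entries of `γ'⁻¹ γ`
  have i00 : ((γ'⁻¹ : Gamma0 N) : SL(2, ℤ)) 0 0 = (γ' : SL(2, ℤ)) 1 1 := by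
    rw [InvMemClass.coe_inv, Matrix.SpecialLinearGroup.SL2_inv_expl]; rfl
  have i01 : ((γ'⁻¹ : Gamma0 N) : SL(2, ℤ)) 0 1 = -(γ' : SL(2, ℤ)) 0 1 := by
    rw [InvMemClass.coe_inv, Matrix.SpecialLinearGroup.SL2_inv_expl]; rfl
  have i10 : ((γ'⁻¹ : Gamma0 N) : SL(2, ℤ)) 1 0 = -(γ' : SL(2, ℤ)) 1 0 := by
    rw [InvMemClass.coe_inv, Matrix.SpecialLinearGroup.SL2_inv_expl]; rfl
  have i11 : ((γ'⁻¹ : Gamma0 N) : SL(2, ℤ)) 1 1 = (γ' : SL(2, ℤ)) 0 0 := by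
    rw [InvMemClass.coe_inv, Matrix.SpecialLinearGroup.SL2_inv_expl]; rfl
  have hdet' := det_entries (γ' : SL(2, ℤ))
  have e00 : ((γ'⁻¹ * γ : Gamma0 N) : SL(2, ℤ)) 0 0 =
      (γ' : SL(2, ℤ)) 1 1 * (γ : SL(2, ℤ)) 0 0 - (γ' : SL(2, ℤ)) 0 1 * (γ : SL(2, ℤ)) 1 0 := by
    rw [gamma0_mul_apply_zero_zero', i00, i01]; ring
  have e01 : ((γ'⁻¹ * γ : Gamma0 N) : SL(2, ℤ)) 0 1 =
      (γ' : SL(2, ℤ)) 1 1 * (γ : SL(2, ℤ)) 0 1 - (γ' : SL(2, ℤ)) 0 1 * (γ : SL(2, ℤ)) 1 1 := by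
    rw [gamma0_mul_apply_zero_one, i00, i01]; ring
  have e10 : ((γ'⁻¹ * γ : Gamma0 N) : SL(2, ℤ)) 1 0 =
      -(γ' : SL(2, ℤ)) 1 0 * (γ : SL(2, ℤ)) 0 0 + (γ' : SL(2, ℤ)) 0 0 * (γ : SL(2, ℤ)) 1 0 := by
    rw [ThetaLayerLambdaCongruenceAtTwo.gamma0_mul_apply_one_zero, i10, i11]
  have e11 : ((γ'⁻¹ * γ : Gamma0 N) : SL(2, ℤ)) 1 1 =
      -(γ' : SL(2, ℤ)) 1 0 * (γ : SL(2, ℤ)) 0 1 + (γ' : SL(2, ℤ)) 0 0 * (γ : SL(2, ℤ)) 1 1 := by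
    rw [gamma0_mul_apply_one_one', i10, i11]
  have hfix : χ (γ'⁻¹ * γ) = 0 := by
    refine chi_eq_zero_of_fix hsmall (γ'⁻¹ * γ) hxy (Or.inl rfl) (ε := 1) ?_ ?_
    · rw [e00, e01]; linear_combination (γ' : SL(2, ℤ)) 1 1 * h0 - (γ' : SL(2, ℤ)) 0 1 * h1 + x * hdet'
    · rw [e10, e11]; linear_combination -(γ' : SL(2, ℤ)) 1 0 * h0 + (γ' : SL(2, ℤ)) 0 0 * h1 + y * hdet'
  have h := hadd γ'⁻¹ γ
  rw [hfix, chi_inv hadd] at h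
  -- `0 = χ γ' + χ γ` in characteristic two
  rw [add_eq_zero_iff_eq_neg.mp h.symm, CharTwo.neg_eq]


/-- Negation invariance of a potential: `φ(−x, −y) = φ(x, y)` (apply `hφ` to `−1 ∈ Γ₀(N)`, killed as a trace `−2` element).
[folklore] -/
theorem phi_neg (hsmall : ∀ γ : Gamma0 N, ((γ : SL(2, ℤ)) 0 0 + (γ : SL(2, ℤ)) 1 1).natAbs ≤ 2 → χ γ = 0)
    (hφ : ∀ (γ : Gamma0 N) (x y : ℤ), IsCoprime x y →
      φ ((γ : SL(2, ℤ)) 0 0 * x + (γ : SL(2, ℤ)) 0 1 * y) ((γ : SL(2, ℤ)) 1 0 * x + (γ : SL(2, ℤ)) 1 1 * y) = χ γ + φ x y)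
    {x y : ℤ} (hxy : IsCoprime x y) : φ (-x) (-y) = φ x y := by
  obtain ⟨e, he00, he01, he10, he11⟩ :=
    ThetaLayerLambdaCongruenceAtTwo.exists_gamma0_entries (N := N) (-1) 0 0 (-1) (by ring) (dvd_zero _)
  have h := hφ e x y hxy
  rw [he00, he01, he10, he11, hsmall e (by rw [he00, he11]; rfl), zero_add] at h
  simpa using h

/-! ## §2. The potential at the cusps `1/w` -/

/-- `φ(1, w)` depends only on `w mod N`: `L_{Nk} = (1 0; Nk 1) ∈ Γ₀(N)` (trace `2`) maps `(1, w)` to `(1, w + Nk)`. [folklore] -/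
theorem phi_one_add_mul (hsmall : ∀ γ : Gamma0 N, ((γ : SL(2, ℤ)) 0 0 + (γ : SL(2, ℤ)) 1 1).natAbs ≤ 2 → χ γ = 0)
    (hφ : ∀ (γ : Gamma0 N) (x y : ℤ), IsCoprime x y →
      φ ((γ : SL(2, ℤ)) 0 0 * x + (γ : SL(2, ℤ)) 0 1 * y) ((γ : SL(2, ℤ)) 1 0 * x + (γ : SL(2, ℤ)) 1 1 * y) = χ γ + φ x y)
    (w k : ℤ) : φ 1 (w + N * k) = φ 1 w := by
  obtain ⟨L, hL00, hL01, hL10, hL11⟩ :=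
    ThetaLayerLambdaCongruenceAtTwo.exists_gamma0_entries (N := N) 1 0 (N * k) 1 (by ring) (dvd_mul_right _ _)
  have h := hφ L 1 w isCoprime_one_left
  rw [hL00, hL01, hL10, hL11, hsmall L (by rw [hL00, hL11]; rfl), zero_add] at h
  have e1 : (1 : ℤ) * 1 + 0 * w = 1 := by ring
  have e2 : (N : ℤ) * k * 1 + 1 * w = w + N * k := by ring
  rwa [e1, e2] at h

/-- `φ(1, w)` is constant on residue classes mod `N` (restatement of `phi_one_add_mul`). [folklore] -/
theorem phi_one_eq_of_dvd_sub (hsmall : ∀ γ : Gamma0 N, ((γ : SL(2, ℤ)) 0 0 + (γ : SL(2, ℤ)) 1 1).natAbs ≤ 2 → χ γ = 0)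
    (hφ : ∀ (γ : Gamma0 N) (x y : ℤ), IsCoprime x y →
      φ ((γ : SL(2, ℤ)) 0 0 * x + (γ : SL(2, ℤ)) 0 1 * y) ((γ : SL(2, ℤ)) 1 0 * x + (γ : SL(2, ℤ)) 1 1 * y) = χ γ + φ x y)
    {w w' : ℤ} (h : (N : ℤ) ∣ w' - w) : φ 1 w' = φ 1 w := by
  obtain ⟨k, hk⟩ := h
  have : w' = w + N * k := by linear_combination hk
  rw [this, phi_one_add_mul hsmall hφ]

/-- **`φ(1, w) = φ(0, 1)` for `w` prime to `N` when `χ` kills `B₁`**: `(1, w)` is the second column of the `|b| = 1` element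
`(a, 1; −Nk, w)` of `Γ₀(N)` (`aw + kN = 1`). [cite: Rademacher1929, §1] -/
theorem phi_one_eq_of_isCoprime (hadd : ∀ γ δ : Gamma0 N, χ (γ * δ) = χ γ + χ δ)
    (hφ : ∀ (γ : Gamma0 N) (x y : ℤ), IsCoprime x y →
      φ ((γ : SL(2, ℤ)) 0 0 * x + (γ : SL(2, ℤ)) 0 1 * y) ((γ : SL(2, ℤ)) 1 0 * x + (γ : SL(2, ℤ)) 1 1 * y) = χ γ + φ x y)
    (hB1 : ∀ β : Gamma0 N, (β : SL(2, ℤ)) 0 1 = -1 → χ β = 0)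
    {w : ℤ} (hw : IsCoprime w N) : φ 1 w = φ 0 1 := by
  obtain ⟨a, k, hak⟩ := hw
  obtain ⟨β, hβ00, hβ01, hβ10, hβ11⟩ :=
    ThetaLayerLambdaCongruenceAtTwo.exists_gamma0_entries (N := N) a 1 (-(N * k)) w (by linear_combination hak)
      (by rw [dvd_neg]; exact dvd_mul_right _ _)
  have hχ : χ β = 0 := forall_b1_of_forall_b_neg_one hadd hB1 β (by rw [hβ01]; rfl)
  have h := hφ β 0 1 isCoprime_one_right
  rw [hβ00, hβ01, hβ10, hβ11, hχ, zero_add] at h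
  have e1 : a * 0 + 1 * 1 = (1 : ℤ) := by ring
  have e2 : -((N : ℤ) * k) * 0 + w * 1 = w := by ring
  rwa [e1, e2] at h

/-- **`φ(1, w) = φ(1, 0)` for `N ∣ w`**: `(1, w)` is the first column of the parabolic `L_w = (1 0; w 1) ∈ Γ₀(N)`.
[folklore] -/
theorem phi_one_eq_of_dvd (hsmall : ∀ γ : Gamma0 N, ((γ : SL(2, ℤ)) 0 0 + (γ : SL(2, ℤ)) 1 1).natAbs ≤ 2 → χ γ = 0)
    (hφ : ∀ (γ : Gamma0 N) (x y : ℤ), IsCoprime x y →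
      φ ((γ : SL(2, ℤ)) 0 0 * x + (γ : SL(2, ℤ)) 0 1 * y) ((γ : SL(2, ℤ)) 1 0 * x + (γ : SL(2, ℤ)) 1 1 * y) = χ γ + φ x y)
    {w : ℤ} (hw : (N : ℤ) ∣ w) : φ 1 w = φ 1 0 := by
  obtain ⟨L, hL00, hL01, hL10, hL11⟩ :=
    ThetaLayerLambdaCongruenceAtTwo.exists_gamma0_entries (N := N) 1 0 w 1 (by ring) hw
  have h := hφ L 1 0 isCoprime_one_left
  rw [hL00, hL01, hL10, hL11, hsmall L (by rw [hL00, hL11]; rfl), zero_add] at h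
  have e1 : (1 : ℤ) * 1 + 0 * 0 = 1 := by ring
  have e2 : w * 1 + 1 * 0 = w := by ring
  rwa [e1, e2] at h

/-- **The `B₁`-move on the cusps `1/x`**: if `(x + 1) u + N k = 1` then `φ(1, 1 − u) = φ(1, x)` — the `b = −1` element
`β = (x+1, −1; Nk, u) ∈ Γ₀(N)` (killed by `hB1`) maps `(1, x)` to `(1, Nk + ux) = (1, 1 − u)`. [cite: Manin1972, §1.6] -/
theorem phi_one_one_sub_eq
    (hφ : ∀ (γ : Gamma0 N) (x y : ℤ), IsCoprime x y →
      φ ((γ : SL(2, ℤ)) 0 0 * x + (γ : SL(2, ℤ)) 0 1 * y) ((γ : SL(2, ℤ)) 1 0 * x + (γ : SL(2, ℤ)) 1 1 * y) = χ γ + φ x y)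
    (hB1 : ∀ β : Gamma0 N, (β : SL(2, ℤ)) 0 1 = -1 → χ β = 0)
    {x u k : ℤ} (h : (x + 1) * u + N * k = 1) : φ 1 (1 - u) = φ 1 x := by
  obtain ⟨β, hβ00, hβ01, hβ10, hβ11⟩ :=
    ThetaLayerLambdaCongruenceAtTwo.exists_gamma0_entries (N := N) (x + 1) (-1) (N * k) u (by linear_combination h)
      (dvd_mul_right _ _)
  have hχ : χ β = 0 := hB1 β hβ01
  have h' := hφ β 1 x isCoprime_one_left
  rw [hβ00, hβ01, hβ10, hβ11, hχ, zero_add] at h'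
  have e1 : (x + 1) * 1 + -1 * x = (1 : ℤ) := by ring
  have e2 : (N : ℤ) * k * 1 + u * x = 1 - u := by linear_combination h
  rwa [e1, e2] at h'

/-! ## §3. The symbol function `S(g) = φ(col₀ g) + φ(col₁ g)` -/

/-- **`S(g) = φ(1, w) − φ(0, 1)` when `d = g₁₁` is prime to `N`**, where `d w ≡ c (mod N)`: `β := g · (1 0; −w 1) ∈ Γ₀(N)`,
`col₁ g = β(0,1)`, `col₀ g = β(1, w)`. [cite: Manin1972, §1.5] -/
theorem phi_col_zero_eq_of_isCoprime_right
    (hφ : ∀ (γ : Gamma0 N) (x y : ℤ), IsCoprime x y →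
      φ ((γ : SL(2, ℤ)) 0 0 * x + (γ : SL(2, ℤ)) 0 1 * y) ((γ : SL(2, ℤ)) 1 0 * x + (γ : SL(2, ℤ)) 1 1 * y) = χ γ + φ x y)
    (g : SL(2, ℤ)) {w k : ℤ} (hw : g 1 0 = g 1 1 * w + N * k) :
    φ (g 0 0) (g 1 0) + φ (g 0 1) (g 1 1) = φ 1 w + φ 0 1 := by
  obtain ⟨β, hβ00, hβ01, hβ10, hβ11⟩ :=
    ThetaLayerLambdaCongruenceAtTwo.exists_gamma0_entries (N := N) (g 0 0 - g 0 1 * w) (g 0 1) (g 1 0 - g 1 1 * w) (g 1 1)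
      (by linear_combination det_entries g) ⟨k, by linear_combination hw⟩
  have h1 := hφ β 0 1 isCoprime_one_right
  have h0 := hφ β 1 w isCoprime_one_left
  rw [hβ00, hβ01, hβ10, hβ11] at h0 h1
  have e1 : (g 0 0 - g 0 1 * w) * 0 + g 0 1 * 1 = g 0 1 := by ring
  have e2 : (g 1 0 - g 1 1 * w) * 0 + g 1 1 * 1 = g 1 1 := by ring
  have e3 : (g 0 0 - g 0 1 * w) * 1 + g 0 1 * w = g 0 0 := by ring
  have e4 : (g 1 0 - g 1 1 * w) * 1 + g 1 1 * w = g 1 0 := by ring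
  rw [e1, e2] at h1
  rw [e3, e4] at h0
  rw [h0, h1]
  -- `(χ β + φ 1 w) + (χ β + φ 0 1) = φ 1 w + φ 0 1`
  have hββ : χ β + χ β = 0 := CharTwo.add_self_eq_zero _
  linear_combination hββ

/-- For `d = g₁₁` prime to `N` there are `w, k` with `c = d w + N k`. [folklore] -/
theorem exists_w_of_isCoprime (g : SL(2, ℤ)) (hd : IsCoprime (g 1 1) N) : ∃ w k : ℤ, g 1 0 = g 1 1 * w + N * k := by
  obtain ⟨a, b, hab⟩ := hd
  exact ⟨a * g 1 0, b * g 1 0, by linear_combination -(g 1 0) * hab⟩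

/-- Column swap: the matrix `(b, −a; d, −c)` is in `SL₂(ℤ)` and `S` is unchanged (`φ` is even). So **if `c = g₁₀` is prime
to `N` then `S(g) = φ(1, w) + φ(0, 1)` with `(−c) w ≡ d`**. [cite: Manin1972, §1.5] -/
theorem phi_col_zero_eq_of_isCoprime_left
    (hsmall : ∀ γ : Gamma0 N, ((γ : SL(2, ℤ)) 0 0 + (γ : SL(2, ℤ)) 1 1).natAbs ≤ 2 → χ γ = 0)
    (hφ : ∀ (γ : Gamma0 N) (x y : ℤ), IsCoprime x y →
      φ ((γ : SL(2, ℤ)) 0 0 * x + (γ : SL(2, ℤ)) 0 1 * y) ((γ : SL(2, ℤ)) 1 0 * x + (γ : SL(2, ℤ)) 1 1 * y) = χ γ + φ x y)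
    (g : SL(2, ℤ)) {w k : ℤ} (hw : g 1 1 = -(g 1 0) * w + N * k) :
    φ (g 0 0) (g 1 0) + φ (g 0 1) (g 1 1) = φ 1 w + φ 0 1 := by
  obtain ⟨g', h00, h01, h10, h11⟩ := exists_sl2_entries (g 0 1) (-(g 0 0)) (g 1 1) (-(g 1 0))
    (by linear_combination det_entries g)
  have h := phi_col_zero_eq_of_isCoprime_right hφ g' (w := w) (k := k) (by rw [h10, h11]; exact hw)
  rw [h00, h01, h10, h11, phi_neg hsmall hφ (isCoprime_apply g)] at h
  rw [← h, add_comm]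

/-! ## §4. From `S ≡ 0` to `χ ≡ 0` through `SL₂(ℤ) = ⟨S, T⟩` -/

/-- **If `φ(col₀ g) = φ(col₁ g)` for every `g ∈ SL₂(ℤ)` then `g ↦ φ(col₁ g)` is constant on `SL₂(ℤ)`**: it is invariant
under right multiplication by `T` (columns `(col₀, col₀ + col₁)`) and by `S` (columns `(col₁, −col₀)`), which generate
`SL₂(ℤ)` (Mathlib `SpecialLinearGroup.SL2Z_generators`). [folklore] -/
theorem phi_col_one_eq_const
    (hsmall : ∀ γ : Gamma0 N, ((γ : SL(2, ℤ)) 0 0 + (γ : SL(2, ℤ)) 1 1).natAbs ≤ 2 → χ γ = 0)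
    (hφ : ∀ (γ : Gamma0 N) (x y : ℤ), IsCoprime x y →
      φ ((γ : SL(2, ℤ)) 0 0 * x + (γ : SL(2, ℤ)) 0 1 * y) ((γ : SL(2, ℤ)) 1 0 * x + (γ : SL(2, ℤ)) 1 1 * y) = χ γ + φ x y)
    (hS : ∀ g : SL(2, ℤ), φ (g 0 0) (g 1 0) = φ (g 0 1) (g 1 1)) (g : SL(2, ℤ)) :
    φ (g 0 1) (g 1 1) = φ 0 1 := by
  -- right-invariance under every element of the closure of `{S, T}`
  have key : ∀ s : SL(2, ℤ), s ∈ Subgroup.closure ({ModularGroup.S, ModularGroup.T} : Set SL(2, ℤ)) →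
      ∀ h : SL(2, ℤ), φ ((h * s) 0 1) ((h * s) 1 1) = φ (h 0 1) (h 1 1) := by
    intro s hs
    induction hs using Subgroup.closure_induction with
    | mem x hx =>
      intro h
      have m01 : (h * x) 0 1 = h 0 0 * x 0 1 + h 0 1 * x 1 1 :=
        (Matrix.two_mul_expl (h : Matrix (Fin 2) (Fin 2) ℤ) (x : Matrix (Fin 2) (Fin 2) ℤ)).2.1
      have m11 : (h * x) 1 1 = h 1 0 * x 0 1 + h 1 1 * x 1 1 :=
        (Matrix.two_mul_expl (h : Matrix (Fin 2) (Fin 2) ℤ) (x : Matrix (Fin 2) (Fin 2) ℤ)).2.2.2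
      rcases hx with rfl | rfl
      · -- `S = (0, −1; 1, 0)`: `col₁(hS) = −col₀ h`
        have s01 : (ModularGroup.S : SL(2, ℤ)) 0 1 = -1 := by rw [ModularGroup.coe_S]; rfl
        have s11 : (ModularGroup.S : SL(2, ℤ)) 1 1 = 0 := by rw [ModularGroup.coe_S]; rfl
        rw [m01, m11, s01, s11]
        have e1 : h 0 0 * -1 + h 0 1 * 0 = -(h 0 0) := by ring
        have e2 : h 1 0 * -1 + h 1 1 * 0 = -(h 1 0) := by ring
        rw [e1, e2, phi_neg hsmall hφ (isCoprime_apply h), hS h]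
      · -- `T = (1, 1; 0, 1)`: `col₁(hT) = col₀ h + col₁ h = col₁ (hT)` and `col₀ (hT) = col₀ h`
        have t01 : (ModularGroup.T : SL(2, ℤ)) 0 1 = 1 := by rw [ModularGroup.coe_T]; rfl
        have t11 : (ModularGroup.T : SL(2, ℤ)) 1 1 = 1 := by rw [ModularGroup.coe_T]; rfl
        have t00 : (ModularGroup.T : SL(2, ℤ)) 0 0 = 1 := by rw [ModularGroup.coe_T]; rfl
        have t10 : (ModularGroup.T : SL(2, ℤ)) 1 0 = 0 := by rw [ModularGroup.coe_T]; rfl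
        have m00 : (h * ModularGroup.T) 0 0 = h 0 0 * (ModularGroup.T : SL(2, ℤ)) 0 0 + h 0 1 * (ModularGroup.T : SL(2, ℤ)) 1 0 :=
          (Matrix.two_mul_expl (h : Matrix (Fin 2) (Fin 2) ℤ) (ModularGroup.T : Matrix (Fin 2) (Fin 2) ℤ)).1
        have m10 : (h * ModularGroup.T) 1 0 = h 1 0 * (ModularGroup.T : SL(2, ℤ)) 0 0 + h 1 1 * (ModularGroup.T : SL(2, ℤ)) 1 0 :=
          (Matrix.two_mul_expl (h : Matrix (Fin 2) (Fin 2) ℤ) (ModularGroup.T : Matrix (Fin 2) (Fin 2) ℤ)).2.2.1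
        have hT := hS (h * ModularGroup.T)
        rw [m00, m10, t00, t10] at hT
        have e1 : h 0 0 * 1 + h 0 1 * 0 = h 0 0 := by ring
        have e2 : h 1 0 * 1 + h 1 1 * 0 = h 1 0 := by ring
        rw [e1, e2] at hT
        rw [← hT, hS h]
    | one => intro h; rw [mul_one]
    | mul x y _ _ ihx ihy => intro h; rw [← mul_assoc, ihy, ihx]
    | inv x _ ihx => intro h; rw [← ihx (h * x⁻¹), inv_mul_cancel_right]
  have hg : g ∈ Subgroup.closure ({ModularGroup.S, ModularGroup.T} : Set SL(2, ℤ)) := by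
    rw [SpecialLinearGroup.SL2Z_generators]; trivial
  have h := key g hg 1
  rw [one_mul] at h
  rw [h]
  rfl

/-- **The engine**: an additive `χ : Γ₀(N) → ZMod 2` killing the trace-`±2` elements, admitting a potential `φ` whose symbol
function vanishes identically on `SL₂(ℤ)`, is zero: `χ γ = φ(col₁ γ) − φ(0, 1) = 0`. [cite: Manin1972, §1.5–1.7] -/
theorem chi_eq_zero_of_phi_col_eq
    (hsmall : ∀ γ : Gamma0 N, ((γ : SL(2, ℤ)) 0 0 + (γ : SL(2, ℤ)) 1 1).natAbs ≤ 2 → χ γ = 0)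
    (hφ : ∀ (γ : Gamma0 N) (x y : ℤ), IsCoprime x y →
      φ ((γ : SL(2, ℤ)) 0 0 * x + (γ : SL(2, ℤ)) 0 1 * y) ((γ : SL(2, ℤ)) 1 0 * x + (γ : SL(2, ℤ)) 1 1 * y) = χ γ + φ x y)
    (hS : ∀ g : SL(2, ℤ), φ (g 0 0) (g 1 0) = φ (g 0 1) (g 1 1)) (γ : Gamma0 N) : χ γ = 0 := by
  have h := hφ γ 0 1 isCoprime_one_right
  have e1 : (γ : SL(2, ℤ)) 0 0 * 0 + (γ : SL(2, ℤ)) 0 1 * 1 = (γ : SL(2, ℤ)) 0 1 := by ring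
  have e2 : (γ : SL(2, ℤ)) 1 0 * 0 + (γ : SL(2, ℤ)) 1 1 * 1 = (γ : SL(2, ℤ)) 1 1 := by ring
  rw [e1, e2, phi_col_one_eq_const hsmall hφ hS (γ : SL(2, ℤ))] at h
  -- `φ 0 1 = χ γ + φ 0 1`
  have : χ γ + φ 0 1 = 0 + φ 0 1 := by rw [zero_add]; exact h.symm
  exact add_right_cancel this

end Potential

end Summit.BirchSwinnertonDyer.BirchSwinnertonDyer.Theorems.SignedMuAtTwo

end
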